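import Mathlib
import HarnessLib
import Summits.HubbardSuperconductivity.HubbardSuperconductivity.Theorems.KLProgrammeH10TwoPointLimitSymbolFrameInstance
import Summits.HubbardSuperconductivity.HubbardSuperconductivity.Theorems.KLProgrammeKLRegimeSymbolAngularFactorSingle

/-!
# Route `KLProgramme` — engine support, route (L2) symbol layer: the CONCRETE SINGLE-multiplier symbol `klAnisoFamily … n ω` on an admissible
# frame — it IS the sample of the continuum symbol `Φ(k₀, p) = Gₙ(k₀² + e_K(p)²)·Z(p)`, and that symbol satisfies the zone, cell and (three-step)
# window hypotheses

Cell `gate-hubbard-kl`, seat p3 (g10); the one-factor twin of p4's `…H10TwoPointLimitSymbolFrameInstance` (pairs), for W1 of the (E4)ₙ supply of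
stmt-HubbardSuperconductivity-20437 (the weighted torus bound of ONE level-`n` sector function; located risk «(b)-Wt@j≥1», cure W1-MIXED).  With
`Gₙ = bgmCutoffSq e₀ (16ⁿ·)`, `e_K ∘ toLp` and the one-factor angular factor `Z` of `…SymbolAngularFactorSingle`:
* **`klAniso_eq_symbol`** — for every product-torus label `q`, `F_ω(k(q)) = Φ(π(1−2M)/β + (2π/β)·val q₁, (2π/L)·q̃₂)`;
* **`symbol₁_vanish`** (bundle: `Φ(k₀, p) = 0` once some `|p_j| ≥ π − z`, and off the shell `Λ_n² < k₀² + e_K²`), **`symbol₁_cell`** (points of the square-with-margin carrying the shell `|e_K| ≤ Λ_n`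
  and `Z ≠ 0` lie within `ρ = (Λ_n + s_max Dt_min (3w_n/4))/(Dt_min − 2A)` of `klFermiPoint μ K θ_{n,ω}`), **`symbol_window₃`**
  (`Λ < |a₀ + h₀ m|` for `m < 3`, `m ≥ 2M − 3` when `Λβ < π(2M − 5)`) — the hypotheses of `…SymbolProductSampled(Zone)` / `…SymbolSampledThird`.
Hypotheses as in the pair file.  Everything is proved; no definitions, no named facts. [folklore]
-/

noncomputable section

namespace Summit.HubbardSuperconductivity.HubbardSuperconductivity.Theorems.TorusFourierL2

set_option linter.dupNamespace false -- summit = problem name (single-conjunct summit), D-0017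

open Set Literature.MathematicalPhysics.QuantumLattice Literature.MathematicalPhysics.QuantumLattice.BandSectorCounting
open Literature.MathematicalPhysics.QuantumLattice.FermiRG Literature.Probability.LatticeModels Literature.Analysis.SpecialFunctions
open Summit.HubbardSuperconductivity.HubbardSuperconductivity.Theorems.DispersionFlow
open Summit.HubbardSuperconductivity.HubbardSuperconductivity.Theorems.KLRegimeSplit
open Summit.HubbardSuperconductivity.HubbardSuperconductivity.Theorems.KLProgrammeLegKernels
open Summit.HubbardSuperconductivity.HubbardSuperconductivity.Theorems.PerturbedFermiCurve
open scoped Real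

section Instance

variable {L M : ℕ} [NeZero L] [NeZero M] {a b : ℝ} (B : BandBounds a b) {K : TrigPolyC4v} {A : ℝ}
  (hA : ∀ p : Momentum, ∀ j ≤ 2, ‖iteratedFDeriv ℝ j (frameShift K) p‖ ≤ A) (hADt : 2 * A < B.Dtmin)
  {μ e₀ z β : ℝ} (he : 0 < e₀) (hz : 0 < z) (hz1 : z ≤ 1) (hgap : e₀ + A + z ^ 2 < -μ) (h3 : e₀ + A - μ ≤ 3)
  (hlo : a ≤ μ - A - e₀) (hhi : μ + A + e₀ ≤ b)
  {n : ℕ} (ω : Fin (sectorCount n))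
  {Z : (Fin 2 → ℝ) → ℝ}
  (hZ : ∀ p, Z p = gnCutoff ((π + z) ^ 2 / π ^ 2) ((π + z) ^ 2) (p 0 ^ 2) * gnCutoff ((π + z) ^ 2 / π ^ 2) ((π + z) ^ 2) (p 1 ^ 2) *
    (radialCutoffC (1 / 2) (momToComplex p) * sectorWeightCirc n ((ω : ℕ) : ℤ) (polarAngle p)))
  {Φ : ℝ × (Fin 2 → ℝ) → ℂ}
  (hΦ : ∀ k₀ p, Φ (k₀, p) = ((bgmCutoffSq e₀ ((16 : ℝ) ^ n * (k₀ ^ 2 + frameLevel μ K (WithLp.toLp 2 p) ^ 2)) * Z p : ℝ) : ℂ))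

include hA h3 he hz hΦ hZ in
/-- **The single multiplier IS the sample of the continuum symbol**: for every product-torus label `q`,
`klAnisoFamily … n ω (k(q)) = Φ(π(1−2M)/β + (2π/β)·val q₁, (2π/L)·q̃₂)`. [cite: BenfattoGiulianiMastropietro2006, §2.5 (2.45)–(2.48)] -/
theorem klAniso_eq_symbol (q : TorusSite 1 (2 * M) × TorusSite 2 L) :
    klAnisoFamily L M β μ K e₀ n ω (⟨(q.1 0).val, ZMod.val_lt (q.1 0)⟩, q.2) =
      Φ (π * (1 - 2 * M) / β + 2 * π / β * (((q.1 0).val : ℕ) : ℝ), fun j => 2 * π / L * (((q.2 j).valMinAbs : ℤ) : ℝ)) := by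
  have hsp := sampledPoint_eq (L := L) (M := M) β q
  rw [← hsp, hΦ]
  set k₀ : ℝ := matsubaraFreq β M (⟨(q.1 0).val, ZMod.val_lt (q.1 0)⟩ : MatsubaraIdx M) with hk₀
  set c : Fin 2 → ℝ := torusCentredMomentum L q.2 with hc
  have he_eq : nambuXiCT L μ K q.2 = frameLevel μ K (WithLp.toLp 2 c) := nambuXiCT_eq_frameLevel L μ K q.2
  have hang : momentumAngle L q.2 = polarAngle c := rfl
  set u : ℝ := k₀ ^ 2 + frameLevel μ K (WithLp.toLp 2 c) ^ 2 with hu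
  have hF : klAnisoFamily L M β μ K e₀ n ω (⟨(q.1 0).val, ZMod.val_lt (q.1 0)⟩, q.2) =
      ((gnScaleCutoff 4 e₀ (-(n : ℤ)) (Real.sqrt u) * sectorWeightCirc n ((ω : ℕ) : ℤ) (polarAngle c) : ℝ) : ℂ) := by
    rw [klAnisoFamily, bgmMultiplier, he_eq, hang]
  rw [hF]
  congr 1
  have hcπ : ∀ j, |c j| ≤ π := abs_torusCentredMomentum_le_pi L q.2
  have hsq : ∀ j, gnCutoff ((π + z) ^ 2 / π ^ 2) ((π + z) ^ 2) (c j ^ 2) = 1 := fun j =>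
    sqCutoff_eq_one hz (by rw [← sq_abs]; exact pow_le_pow_left₀ (abs_nonneg _) (hcπ j) 2)
  rw [hZ c, hsq 0, hsq 1, one_mul, one_mul]
  by_cases hR : (1 : ℝ) / 2 ≤ ‖momToComplex c‖
  · rw [radialCutoffC_eq_one (by norm_num) hR, one_mul, gnScaleCutoff_sqrt_eq_bgmCutoffSq]
  · have hnot : ¬ (1 : ℝ) ≤ ‖momToComplex c‖ := fun h1 => hR (by linarith)
    have hbig : e₀ < |frameLevel μ K (WithLp.toLp 2 c)| := by
      by_contra hle
      exact hnot (one_le_norm_of_frameBand_le hA h3 (not_lt.1 hle))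
    have h1 : gnScaleCutoff 4 e₀ (-(n : ℤ)) (Real.sqrt u) = 0 := gnScaleCutoff_eq_zero_of_band_gt he n hbig
    have h1' : bgmCutoffSq e₀ ((16 : ℝ) ^ n * u) = 0 := by rw [← gnScaleCutoff_sqrt_eq_bgmCutoffSq]; exact h1
    rw [h1, h1']; ring

include hA hz hz1 hgap he hΦ hZ in
/-- **Vanishing of the continuum symbol** (one bundle, so as not to shadow the pair file's statement shapes): (i) ZONE — `Φ(k₀, p) = 0` as soon as
some `|p_j| ≥ π − z`; (ii) OFF-SHELL — `Φ(k₀, p) = 0` as soon as `Λ_n² < k₀² + e_K(p)²`. [folklore] -/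
theorem symbol₁_vanish :
    (∀ (k₀ : ℝ) (p : Fin 2 → ℝ), (∃ j, π - z ≤ |p j|) → Φ (k₀, p) = 0) ∧
      ∀ (k₀ : ℝ) (p : Fin 2 → ℝ), klScale e₀ n ^ 2 < k₀ ^ 2 + frameLevel μ K (WithLp.toLp 2 p) ^ 2 → Φ (k₀, p) = 0 := by
  obtain ⟨d, -, hd1, hd2⟩ := exists_abs_derivs_bgmCutoffSq_le he
  have hoff : ∀ (k₀ : ℝ) (p : Fin 2 → ℝ), klScale e₀ n ^ 2 < k₀ ^ 2 + frameLevel μ K (WithLp.toLp 2 p) ^ 2 → Φ (k₀, p) = 0 := by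
    intro k₀ p hu
    rw [hΦ, (scaleProfile_bounds he n hd1 hd2).2.2.2.2 _ hu]; simp
  refine ⟨fun k₀ p hp => ?_, hoff⟩
  obtain ⟨j, hj⟩ := hp
  rcases le_or_gt (π + z) |p j| with hfar | hnear
  · rw [hΦ, (angularFactor₁_smooth_abs_zone hZ hz).2.2 p ⟨j, hfar⟩]; simp
  · have hband : e₀ < |frameLevel μ K (WithLp.toLp 2 p)| := frameBand_zone hA hz1 hgap hj hnear.le
    refine hoff k₀ p ?_
    have h1 := klScale_le_e0 he.le n
    have h2 : 0 < klScale e₀ n := by rw [klScale]; positivity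
    have h3' : e₀ ^ 2 < frameLevel μ K (WithLp.toLp 2 p) ^ 2 := by
      have := sq_lt_sq' (by linarith [abs_nonneg (frameLevel μ K (WithLp.toLp 2 p))]) hband
      rwa [sq_abs] at this
    nlinarith [pow_le_pow_left₀ h2.le h1 2, sq_nonneg k₀]

include B hA hADt hz hz1 hgap he hlo hhi hZ in
/-- **Cell**: a point of the square-with-margin in the shell `|e_K| ≤ Λ_n` with `Z ≠ 0` is within `(Λ_n + s_max Dt_min (3w_n/4))/(Dt_min − 2A)`
of `klFermiPoint μ K θ_{n,ω}` (sup norm). [cite: BenfattoGiulianiMastropietro2006, §2.7 (2.69)] -/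
theorem symbol₁_cell (p : Fin 2 → ℝ) (hsq : ∀ i, |p i| ≤ π + z) (hshell : |frameLevel μ K (WithLp.toLp 2 p)| ≤ klScale e₀ n)
    (hZp : Z p ≠ 0) :
    ‖p - klFermiPoint μ K (sectorCenter n (ω : ℕ))‖ ≤
      (klScale e₀ n + B.smax * B.Dtmin * (3 * sectorWidth n / 4)) / (B.Dtmin - 2 * A) := by
  have hΛ := klScale_le_e0 he.le n
  have hζ := angularFactor₁_support hZ hZp
  exact frameBand_cell B hA hADt hz.le hz1 (by linarith) (by linarith) (by linarith) n (ω : ℕ) hsq hshell hζ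

omit [NeZero M] in
/-- **Three-step window**: if `Λβ < π(2M − 5)` then `Λ < |π(1−2M)/β + (2π/β) m|` for all integers `m < 3` and `m ≥ 2M − 3` (`β > 0`):
the symbol's frequency window sits three steps inside the kept Matsubara frequencies. [folklore] -/
theorem symbol_window₃ {Λ β : ℝ} (hβ : 0 < β) (hM : Λ * β < π * (2 * M - 5)) (m : ℤ) (hm : m < 3 ∨ ((2 * M : ℕ) : ℤ) ≤ m + 3) :
    Λ < |π * (1 - 2 * M) / β + 2 * π / β * (m : ℝ)| := by
  have hπ := Real.pi_pos
  have e : π * (1 - 2 * M) / β + 2 * π / β * (m : ℝ) = π * (2 * (m : ℝ) + 1 - 2 * M) / β := by field_simp; ring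
  rw [e, abs_div, abs_of_pos hβ, lt_div_iff₀ hβ, abs_mul, abs_of_pos hπ]
  refine lt_of_lt_of_le hM (mul_le_mul_of_nonneg_left ?_ hπ.le)
  rcases hm with hm | hm
  · have hm' : (m : ℝ) ≤ 2 := by exact_mod_cast (by omega : m ≤ 2)
    rw [le_abs]; right; linarith
  · have hm' : (2 * (M : ℝ)) - 3 ≤ (m : ℝ) := by
      have : (2 * M : ℤ) - 3 ≤ m := by push_cast at hm ⊢; omega
      exact_mod_cast this
    rw [le_abs]; left; linarith

end Instance

end Summit.HubbardSuperconductivity.HubbardSuperconductivity.Theorems.TorusFourierL2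

end
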